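import Literature.InformationTheory.QuantumCodes.CSSPhenomenologicalAnisotropic
import Literature.InformationTheory.QuantumCodes.HypergraphProductThresholds
import HarnessLib

/-!
# Planar surface codes under inhomogeneous independent noise and two-rate (`p ≠ q`) phenomenological noise:
# the certified `p₀(3)` and `p₀(5)` bounds with `p` = the largest rate — proved

Topic `Literature/InformationTheory/QuantumCodes` (venture QEC, LADDER-QEC Q5, PARTITION row 09 "noise models"; qec-type-09
gen 4, item 09.ANISO). Companion of `HypergraphProductThresholds.lean` §Planar (`planar_codeCapacityThreshold`:
`36 p(1-p) < 1 ⇒ Prob_fail → 0`; `planar_phenomThreshold`: `T(k)` noisy rounds, `q = p`, `100 p(1-p) < 1`; both sectors)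
and of `CSSPhenomenologicalAnisotropic.lean` (the generic two-rate / inhomogeneous DKP15 bounds). Instances for
Dennis–Kitaev–Landahl–Preskill's planar codes (`planarHX k`, `planarHZ k`), all PROVED, 0 facts:

* `planar_growth`, `planar_growth'`, `planar_phenom_growth`, `planar_phenom_growth'` — the subexponential-size
  hypotheses of the generic theorems, factored out of the i.i.d. proofs (polynomial size × linear distance);
* **`planar_codeCapacityThreshold_inhom`** (+ `'` for the `H_Z`-sector): independent flips with qubit-dependent rates
  `0 ≤ p_{k,v} ≤ ρ`, `36 ρ(1-ρ) < 1` ⇒ `Prob_fail → 0`, every minimum-weight decoder family;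
* **`planar_phenomThreshold_aniso`** (+ `'`): `T(k)` rounds (poly-bounded), qubit rate `p`, measurement rate `q`,
  `0 ≤ p, q ≤ ρ`, `100 ρ(1-ρ) < 1` ⇒ `Prob_fail(p, q) → 0`, every minimum-weight space-time decoder family.

## References
* [DennisEtAl2002] E. Dennis, A. Kitaev, A. Landahl, J. Preskill, *Topological quantum memory*, J. Math. Phys. 43
  (2002) 4452–4505, arXiv:quant-ph/0110143, §3.2 (planar codes), §4.2 (rates p, q), §5.3.
* [DumerKovalevPryadko2015] I. Dumer, A. A. Kovalev, L. P. Pryadko, PRL 115 (2015) 050502, Thm 2 (y = 0), Thm 3, p. 5.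
-/

namespace Literature.InformationTheory.QuantumCodes

open Finset Matrix Filter Topology

/-- Polynomial weight, linear distance: `A (k+2)^m r^{k+2} → 0` for `0 < r < 1`.
[cite: DennisEtAl2002, §5.3 (L² μ^L (4p̃)^{L/2} → 0)] -/
theorem tendsto_const_mul_pow_mul_pow {r : ℝ} (hr0 : 0 < r) (hr1 : r < 1) (A : ℝ) (m : ℕ) :
    Tendsto (fun k : ℕ => A * ((k : ℝ) + 2) ^ m * r ^ (k + 2)) atTop (𝓝 0) := by
  have h0 := tendsto_pow_const_mul_const_pow_of_abs_lt_one m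
    (show |r| < 1 by rwa [abs_of_nonneg hr0.le])
  have h1 : Tendsto (fun k : ℕ => ((k + 2 : ℕ) : ℝ) ^ m * r ^ (k + 2)) atTop (𝓝 0) :=
    (Filter.tendsto_add_atTop_iff_nat 2).2 h0
  have h2 := h1.const_mul A
  rw [mul_zero] at h2
  refine h2.congr fun k => ?_
  push_cast
  ring

/-- **Growth hypothesis of the planar family, `H_X`-sector, code capacity**: `|Q_k| r^{k+2} → 0` for `0 < r < 1`.
[cite: DennisEtAl2002, §5.3 (polynomial prefactor × geometric decay)] -/
theorem planar_growth (r : ℝ) (hr0 : 0 < r) (hr1 : r < 1) :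
    Tendsto (fun k => (Fintype.card (PlanarQubit k) : ℝ) * r ^ (k + 2)) atTop (𝓝 0) := by
  have h := tendsto_const_mul_pow_mul_pow hr0 hr1 2 2
  refine squeeze_zero (fun k => by positivity) (fun k => ?_) h
  rw [card_planarQubit]
  have hrk : 0 ≤ r ^ (k + 2) := pow_nonneg hr0.le _
  have hpoly : (((k + 2) ^ 2 + (k + 1) ^ 2 : ℕ) : ℝ) ≤ 2 * ((k : ℝ) + 2) ^ 2 := by
    have hk : (0 : ℝ) ≤ k := Nat.cast_nonneg k
    push_cast
    nlinarith
  exact mul_le_mul_of_nonneg_right hpoly hrk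

/-- **Growth hypothesis of the planar family, `H_X`-sector, `T(k)` noisy rounds** (`T` polynomially bounded):
`(|Q_k| + |C_k|) T(k) r^{k+2} → 0`. [cite: DennisEtAl2002, §5.3 (T increasing no faster than a polynomial of L)] -/
theorem planar_phenom_growth {T : ℕ → ℕ} (hT : ToricCode.IsPolyBounded T) (r : ℝ) (hr0 : 0 < r) (hr1 : r < 1) :
    Tendsto (fun k => (((Fintype.card (PlanarQubit k) + Fintype.card (PlanarCheck k)) * T k : ℕ) : ℝ) *
      r ^ (k + 2)) atTop (𝓝 0) := by
  obtain ⟨A, m, hAm⟩ := hT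
  have hA0 : 0 ≤ A := by
    have h := hAm 0
    simp only [Nat.cast_zero, zero_add, one_pow, mul_one] at h
    exact le_trans (Nat.cast_nonneg _) h
  have h := tendsto_const_mul_pow_mul_pow hr0 hr1 (3 * A) (m + 2)
  refine squeeze_zero (fun k => by positivity) (fun k => ?_) h
  rw [card_planarQubit, card_planarCheck]
  have hrk : 0 ≤ r ^ (k + 2) := pow_nonneg hr0.le _
  have hTk := hAm k
  have hk1 : ((k : ℝ) + 1) ^ m ≤ ((k : ℝ) + 2) ^ m :=
    pow_le_pow_left₀ (by positivity) (by linarith) m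
  have hTk' : (T k : ℝ) ≤ A * ((k : ℝ) + 2) ^ m := hTk.trans (mul_le_mul_of_nonneg_left hk1 hA0)
  have hsize : ((((k + 2) ^ 2 + (k + 1) ^ 2 + (k + 1) * (k + 2)) * T k : ℕ) : ℝ) ≤
      3 * A * ((k : ℝ) + 2) ^ (m + 2) := by
    push_cast
    have hpoly : (((k : ℝ) + 2) ^ 2 + ((k : ℝ) + 1) ^ 2 + ((k : ℝ) + 1) * ((k : ℝ) + 2)) ≤
        3 * ((k : ℝ) + 2) ^ 2 := by
      have hk : (0 : ℝ) ≤ k := Nat.cast_nonneg k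
      nlinarith
    have hT0 : 0 ≤ (T k : ℝ) := Nat.cast_nonneg _
    calc (((k : ℝ) + 2) ^ 2 + ((k : ℝ) + 1) ^ 2 + ((k : ℝ) + 1) * ((k : ℝ) + 2)) * (T k : ℝ)
        ≤ 3 * ((k : ℝ) + 2) ^ 2 * (A * ((k : ℝ) + 2) ^ m) :=
          mul_le_mul hpoly hTk' hT0 (by positivity)
      _ = 3 * A * ((k : ℝ) + 2) ^ (m + 2) := by ring
  exact mul_le_mul_of_nonneg_right hsize hrk

/-- **Growth hypothesis, `H_Z`-sector, `T(k)` noisy rounds**: `(|Q_k| + |Z-checks_k|) T(k) r^{k+2} → 0`.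
[cite: DennisEtAl2002, §5.3] -/
theorem planar_phenom_growth' {T : ℕ → ℕ} (hT : ToricCode.IsPolyBounded T) (r : ℝ) (hr0 : 0 < r) (hr1 : r < 1) :
    Tendsto (fun k => (((Fintype.card (PlanarQubit k) + Fintype.card (PlanarZCheck k)) * T k : ℕ) : ℝ) *
      r ^ (k + 2)) atTop (𝓝 0) := by
  have h := planar_phenom_growth hT r hr0 hr1
  refine h.congr fun k => ?_
  rw [card_planarCheck, card_planarZCheck, Nat.mul_comm (k + 1) (k + 2)]

open Classical in
/-- **Planar surface codes, code capacity with INHOMOGENEOUS independent noise, `H_X`-sector**: for every family of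
minimum-weight decoders and qubit-dependent flip rates `0 ≤ p_{k,v} ≤ ρ` with `36 ρ(1-ρ) < 1` (`ρ < p₀(3) ≈ .0286`):
`Prob_fail → 0`. UNCONDITIONAL. [cite: DumerKovalevPryadko2015, Thm 2 (y = 0, w = 4)] -/
theorem planar_codeCapacityThreshold_inhom (D : ∀ k, Decoder (PlanarCheck k → ZMod 2) (PlanarQubit k → ZMod 2))
    (hD : ∀ k, (D k).IsMinWeight (fun e => planarHX k *ᵥ e) {x | planarHX k *ᵥ x = 0} hammingNorm)
    {rate : ∀ k, PlanarQubit k → ℝ} {ρ : ℝ} (hr0 : ∀ k v, 0 ≤ rate k v) (hrρ : ∀ k v, rate k v ≤ ρ)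
    (hρ0 : 0 ≤ ρ) (hρ : ρ ≤ 1 / 2) (h36 : 36 * (ρ * (1 - ρ)) < 1) :
    Tendsto (fun k => ∑ e ∈ univ.filter (fun e : PlanarQubit k → ZMod 2 =>
        ¬ (D k).Corrects (fun e => planarHX k *ᵥ e) (planarSZ k : Set (PlanarQubit k → ZMod 2)) e),
        indepWeight (rate k) (supp e)) atTop (𝓝 0) :=
  codeCapacityThreshold_inhom_of_rowWeight' planarHX planarSZ D hD (w := 4) (by norm_num)
    card_rowSupp_planarHX_le (fun k => k + 2) (fun k => by omega) le_hammingNorm_of_planar_cycle planar_growth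
    hr0 hrρ hρ0 hρ (by norm_num; linarith)

open Classical in
/-- **`H_Z`-sector twin**: inhomogeneous rates `≤ ρ`, `36 ρ(1-ρ) < 1` ⇒ `Prob_fail → 0`. UNCONDITIONAL.
[cite: DumerKovalevPryadko2015, Thm 2 (y = 0, w = 4)] -/
theorem planar_codeCapacityThreshold_inhom' (D : ∀ k, Decoder (PlanarZCheck k → ZMod 2) (PlanarQubit k → ZMod 2))
    (hD : ∀ k, (D k).IsMinWeight (fun e => planarHZ k *ᵥ e) {x | planarHZ k *ᵥ x = 0} hammingNorm)
    {rate : ∀ k, PlanarQubit k → ℝ} {ρ : ℝ} (hr0 : ∀ k v, 0 ≤ rate k v) (hrρ : ∀ k v, rate k v ≤ ρ)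
    (hρ0 : 0 ≤ ρ) (hρ : ρ ≤ 1 / 2) (h36 : 36 * (ρ * (1 - ρ)) < 1) :
    Tendsto (fun k => ∑ e ∈ univ.filter (fun e : PlanarQubit k → ZMod 2 =>
        ¬ (D k).Corrects (fun e => planarHZ k *ᵥ e) (planarSX k : Set (PlanarQubit k → ZMod 2)) e),
        indepWeight (rate k) (supp e)) atTop (𝓝 0) :=
  codeCapacityThreshold_inhom_of_rowWeight' planarHZ planarSX D hD (w := 4) (by norm_num)
    card_rowSupp_planarHZ_le (fun k => k + 2) (fun k => by omega) le_hammingNorm_of_planar_cocycle planar_growth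
    hr0 hrρ hρ0 hρ (by norm_num; linarith)

/-- **Planar surface codes, `T(k)` noisy rounds with qubit rate `p` and measurement rate `q`, `H_X`-sector**: for
every polynomially bounded schedule, every family of minimum-weight space-time decoders and `0 ≤ p, q ≤ ρ` with
`100 ρ(1-ρ) < 1` (`ρ < p₀(5) ≈ .0101`): `Prob_fail(p, q) → 0`. UNCONDITIONAL.
[cite: DumerKovalevPryadko2015, Thm 3 with p. 5 (w → w + 2); DKLP §5.3 (p, q)] -/
theorem planar_phenomThreshold_aniso (T : ℕ → ℕ) (hT : ToricCode.IsPolyBounded T)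
    (D : ∀ k, CSSPhenom.STDecoder (PlanarCheck k) (PlanarQubit k) (T k))
    (hD : ∀ k, (D k).IsMinWeight (CSSPhenom.stSyn (planarHX k) (T k))
      (CSSPhenom.stCycles (planarHX k) (T k)) hammingNorm)
    {p q ρ : ℝ} (hp0 : 0 ≤ p) (hq0 : 0 ≤ q) (hpρ : p ≤ ρ) (hqρ : q ≤ ρ) (hρ : ρ ≤ 1 / 2)
    (h100 : 100 * (ρ * (1 - ρ)) < 1) :
    Tendsto (fun k => CSSPhenom.phenomFailureProb (planarHX k) (T k)
      (planarSZ k : Set (PlanarQubit k → ZMod 2)) (D k) p q) atTop (𝓝 0) :=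
  CSSPhenom.phenomThreshold_aniso_of_rowWeight' planarHX planarSZ T D hD (w := 4) card_rowSupp_planarHX_le
    (fun k => k + 2) (fun k => by omega) le_hammingNorm_of_planar_cycle (planar_phenom_growth hT) hp0 hq0 hpρ hqρ hρ
    (by norm_num; linarith)

/-- **`H_Z`-sector twin**: `0 ≤ p, q ≤ ρ`, `100 ρ(1-ρ) < 1` ⇒ `Prob_fail(p, q) → 0`. UNCONDITIONAL.
[cite: DumerKovalevPryadko2015, Thm 3 with p. 5 (w → w + 2)] -/
theorem planar_phenomThreshold_aniso' (T : ℕ → ℕ) (hT : ToricCode.IsPolyBounded T)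
    (D : ∀ k, CSSPhenom.STDecoder (PlanarZCheck k) (PlanarQubit k) (T k))
    (hD : ∀ k, (D k).IsMinWeight (CSSPhenom.stSyn (planarHZ k) (T k))
      (CSSPhenom.stCycles (planarHZ k) (T k)) hammingNorm)
    {p q ρ : ℝ} (hp0 : 0 ≤ p) (hq0 : 0 ≤ q) (hpρ : p ≤ ρ) (hqρ : q ≤ ρ) (hρ : ρ ≤ 1 / 2)
    (h100 : 100 * (ρ * (1 - ρ)) < 1) :
    Tendsto (fun k => CSSPhenom.phenomFailureProb (planarHZ k) (T k)
      (planarSX k : Set (PlanarQubit k → ZMod 2)) (D k) p q) atTop (𝓝 0) :=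
  CSSPhenom.phenomThreshold_aniso_of_rowWeight' planarHZ planarSX T D hD (w := 4) card_rowSupp_planarHZ_le
    (fun k => k + 2) (fun k => by omega) le_hammingNorm_of_planar_cocycle (planar_phenom_growth' hT) hp0 hq0 hpρ hqρ
    hρ (by norm_num; linarith)

end Literature.InformationTheory.QuantumCodes
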